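import Literature.NumberTheory.Kottwitz1992.ModuliProblem
import Literature.RingTheory.CentralSimple.InvolutionsFirstKindTypes   -- ★ KMRT Prop. (2.6) (1): `InvolutionFirstKind.finrank_symmSubmodule_eq_or`
import Mathlib.RingTheory.SimpleRing.Field
import HarnessLib

/-!
# [Kottwitz1992, §5 p. 391] The case trichotomy A ∕ C ∕ D — DISCHARGED: `Kottwitz1992_5_cases_holds`

Kernel-lane companion of the statement carpet ★ `Literature/NumberTheory/Kottwitz1992/ModuliProblem.lean` (squad TK; precedents ★
`ModuliProblemHolds`, ★ `ModuliProblemMEvenHolds`): the named fact ★ `ModuliProblem.Kottwitz1992_5_cases` — for the rational PEL datum of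
§5 exactly one of Case A (`*` of the second kind), Case C (`*` of the first kind, `2 dim_ℚ Sym(B, *) = [F : ℚ] d(d + 1)`) and Case D (`*` of
the first kind, `2 dim_ℚ Sym(B, *) + [F : ℚ] d = [F : ℚ] d²`) holds, `dim_ℚ B = d² [F : ℚ]` — is PROVED here as
`theorem Kottwitz1992_5_cases_holds : Kottwitz1992_5_cases`.  THEOREMS ONLY (no definition, no named fact, no `sorry`, no instance, no
notation); cell hodgecm-mathlib, seat B-typ04 (g30); net debt −1.

R. E. Kottwitz, *Points on some Shimura varieties over finite fields*, J. Amer. Math. Soc. 5 (1992), §5 p. 391 L23–L41 (held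
`paper:doi-10-2307-2152772`, p0019).  THE PRINT: «our moduli problems fall into three families (Cases A, C, and D) […] In Case A the
involution `*` is of the second kind […] In Cases C and D the involution is of the first kind (`F = F₀`) […] over an algebraic closure of
`F₀`, the group `G₀` is a symplectic group in `2n` variables in Case C and an orthogonal group in `2n` variables in Case D».  The typed
letter encodes C ∕ D by the type (orthogonal ∕ symplectic) of `*` on `B` through `dim Sym(B, *)` (★ `IsCaseC`, ★ `IsCaseD`).  No proof
is printed; THE PROOF GIVEN HERE is the dimension dichotomy for involutions of the first kind, Knus–Merkurjev–Rost–Tignol Prop. (2.6) (1)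
— a THEOREM of the tree used BY NAME, ★ `Literature.RingTheory.CentralSimple.InvolutionFirstKind.finrank_symmSubmodule_eq_or`: §1 if
`*` moves a central element we are in Case A and in neither C nor D (both require `*` trivial on the centre); §2 otherwise the centre
`F = Z(B)` of the simple ring `B` is a field (Mathlib `IsSimpleRing.isField_center`), `B` is central simple of finite degree over `F`, and
`*`, being trivial on `F`, is an `F`-linear involution of the first kind, so `[B : F] = d²` and `dim_F Sym(B, *) ∈ {d(d+1)/2, d(d−1)/2}`
(KMRT (2.6) (1), `char F = 0 ≠ 2`); reading `ℚ`-dimensions as `[F : ℚ]` times `F`-dimensions gives Case C or Case D, and the two exclude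
each other because `d(d+1) ≠ d(d−1)` for `d ≥ 1` (and `d` is determined by `dim_ℚ B = d² [F : ℚ]`).
HONEST LABEL: HC_CM is proved only modulo the 7 printed citations (2 remaining: hLiu418, h413) until rung 0 closes; this file adds no citation
debt (0 facts, 0 sorry) and discharges 1 named fact of ★ `ModuliProblem`.

## References
* [Kottwitz1992] R. E. Kottwitz, Points on some Shimura varieties over finite fields, J. Amer. Math. Soc. 5 (1992) 373–444, §5 p. 391.
* [KnusEtAl1998] M.-A. Knus, A. Merkurjev, M. Rost, J.-P. Tignol, The Book of Involutions, AMS Coll. Publ. 44 (1998), Ch. I §2.A Prop. (2.6)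
  (the tree's `InvolutionsFirstKindTypes`).
-/

noncomputable section

namespace Literature.NumberTheory.Kottwitz1992.ModuliProblem

open Module
open Literature.RingTheory.CentralSimple

universe u v

/-- `2 · C(n+1, 2) = n (n+1)`. [folklore] -/
private theorem two_mul_choose_two_succ (n : ℕ) : 2 * (n + 1).choose 2 = n * (n + 1) := by
  have h := Nat.add_one_mul_choose_eq n 1
  rw [Nat.choose_one_right] at h
  rw [mul_comm 2, ← h, mul_comm]

/-- `2 · C(n, 2) + n = n²`. [folklore] -/
private theorem two_mul_choose_two_add (n : ℕ) : 2 * n.choose 2 + n = n * n := by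
  cases n with
  | zero => simp
  | succ m =>
    have h := Nat.add_one_mul_choose_eq m 1
    rw [Nat.choose_one_right] at h
    nlinarith [h]

/-- **The first-kind dichotomy on `(B, *)`**: `B` a finite-dimensional simple `ℚ`-algebra with an involution `*` trivial on the centre `F`;
then `dim_ℚ B = d² [F : ℚ]` for some `d ≥ 1` and either `2 dim_ℚ Sym(B, *) = [F : ℚ] d(d+1)` (orthogonal type) or
`2 dim_ℚ Sym(B, *) + [F : ℚ] d = [F : ℚ] d²` (symplectic type) — KMRT Prop. (2.6) (1) over the field `F = Z(B)`, read over `ℚ`.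
[cite: KnusEtAl1998, Ch. I §2.A Prop. (2.6) (1) (p. 17)] -/
private theorem firstKind_dichotomy (B : Type u) [Ring B] [Algebra ℚ B] [StarRing B] [StarModule ℚ B] [FiniteDimensional ℚ B]
    [IsSimpleRing B] (hfix : ∀ x ∈ Subalgebra.center ℚ B, star x = x) :
    ∃ d : ℕ, 0 < d ∧ 0 < finrank ℚ (Subalgebra.center ℚ B) ∧
      finrank ℚ B = d ^ 2 * finrank ℚ (Subalgebra.center ℚ B) ∧
      (2 * finrank ℚ (selfAdjoint.submodule ℚ B) = finrank ℚ (Subalgebra.center ℚ B) * (d * (d + 1)) ∨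
        2 * finrank ℚ (selfAdjoint.submodule ℚ B) + finrank ℚ (Subalgebra.center ℚ B) * d =
          finrank ℚ (Subalgebra.center ℚ B) * d ^ 2) := by
  /- the centre `F = Z(B)` is a field and `B` is a central simple `F`-algebra of finite degree -/
  set Z : Subalgebra ℚ B := Subalgebra.center ℚ B with hZdef
  have hZ : IsField Z :=
    MulEquiv.isField (IsSimpleRing.isField_center B)
      ({ toFun := fun x => ⟨x.1, Subring.mem_center_iff.2 (Subalgebra.mem_center_iff.1 x.2)⟩
         invFun := fun x => ⟨x.1, Subalgebra.mem_center_iff.2 (Subring.mem_center_iff.1 x.2)⟩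
         left_inv := fun _ => rfl
         right_inv := fun _ => rfl
         map_mul' := fun _ _ => rfl } : Z ≃* Subring.center B)
  letI : Field Z := hZ.toField
  letI : Algebra Z B := Algebra.ofModule
    (fun c x y => by rw [Subalgebra.smul_def, Subalgebra.smul_def, smul_eq_mul, smul_eq_mul, mul_assoc])
    (fun c x y => by
      rw [Subalgebra.smul_def, Subalgebra.smul_def, smul_eq_mul, smul_eq_mul, ← mul_assoc, Subalgebra.mem_center_iff.1 c.2 x,
        mul_assoc])
  have halg : ∀ c : Z, algebraMap Z B c = (c : B) := fun c => by
    rw [Algebra.algebraMap_eq_smul_one, Subalgebra.smul_def, smul_eq_mul, mul_one]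
  haveI : IsScalarTower ℚ Z B := ⟨fun r c a => by
    rw [Subalgebra.smul_def, Subalgebra.smul_def, Subalgebra.coe_smul, smul_eq_mul, smul_eq_mul, smul_mul_assoc]⟩
  haveI : Module.Finite Z B := Module.Finite.of_restrictScalars_finite ℚ Z B
  haveI : Algebra.IsCentral Z B := ⟨fun z hz => by
    rw [Subalgebra.mem_center_iff] at hz
    exact Algebra.mem_bot.2 ⟨⟨z, Subalgebra.mem_center_iff.2 hz⟩, halg _⟩⟩
  haveI : FiniteDimensional ℚ Z := Module.Finite.of_injective Z.val.toLinearMap Subtype.val_injective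
  -- `char F ≠ 2`
  haveI : NeZero (2 : Z) := ⟨fun h =>
    two_ne_zero ((algebraMap ℚ Z).injective (by rw [map_ofNat, map_zero]; exact h))⟩
  /- `*` is an `F`-linear involution of the first kind -/
  obtain ⟨σ, hσ⟩ : ∃ σ : B →ₗ[Z] B, ∀ x, σ x = star x :=
    ⟨{ toFun := star
       map_add' := star_add
       map_smul' := fun c x => by
         rw [RingHom.id_apply, Subalgebra.smul_def, Subalgebra.smul_def, smul_eq_mul, smul_eq_mul, star_mul, hfix _ c.2,
           Subalgebra.mem_center_iff.1 c.2 (star x)] }, fun _ => rfl⟩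
  have hmul : ∀ x y, σ (x * y) = σ y * σ x := fun x y => by rw [hσ, hσ, hσ, star_mul]
  have hinv : ∀ x, σ (σ x) = x := fun x => by rw [hσ, hσ, star_star]
  /- KMRT (2.6) (1) -/
  obtain ⟨n, hn, hcases⟩ := InvolutionFirstKind.finrank_symmSubmodule_eq_or σ hmul hinv
  -- `Sym(B, *)` over `ℚ` and over `F`
  have hmem : ∀ x : B, x ∈ symmSubmodule σ ↔ x ∈ selfAdjoint.submodule ℚ B := fun x => by
    rw [mem_symmSubmodule_iff, hσ]
    exact (selfAdjoint.mem_iff (x := x)).symm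
  let e : ↥(symmSubmodule σ) ≃ₗ[ℚ] ↥(selfAdjoint.submodule ℚ B) :=
    { toFun := fun x => ⟨(x : B), (hmem x.1).mp x.2⟩
      invFun := fun x => ⟨(x : B), (hmem x.1).mpr x.2⟩
      map_add' := fun _ _ => rfl
      map_smul' := fun _ _ => rfl
      left_inv := fun _ => rfl
      right_inv := fun _ => rfl }
  have hsym : finrank ℚ (selfAdjoint.submodule ℚ B) = finrank ℚ Z * finrank Z (symmSubmodule σ) := by
    rw [← e.finrank_eq, Module.finrank_mul_finrank]
  have htower : finrank ℚ B = finrank ℚ Z * finrank Z B := (Module.finrank_mul_finrank ℚ Z B).symm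
  have hzpos : 0 < finrank ℚ Z := finrank_pos
  have hn0 : 0 < n := by
    rcases Nat.eq_zero_or_pos n with rfl | h
    · exfalso
      rw [pow_two, mul_zero] at hn
      exact (finrank_pos (R := Z) (M := B)).ne' hn
    · exact h
  refine ⟨n, hn0, hzpos, by rw [htower, hn, mul_comm], ?_⟩
  rcases hcases with ⟨hS, -⟩ | ⟨hS, -, -⟩
  · left
    rw [hsym, hS, ← mul_assoc, mul_comm 2, mul_assoc, two_mul_choose_two_succ]
  · right
    rw [hsym, hS, pow_two, ← mul_assoc, mul_comm 2, mul_assoc, ← mul_add, two_mul_choose_two_add]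

/-- **§5 The case trichotomy, PROVED**: ★ `Kottwitz1992_5_cases` holds — for the rational PEL datum of §5 exactly one of Cases A, C, D
holds (second kind ∕ first kind of orthogonal type on `B` ∕ first kind of symplectic type on `B`), by KMRT Prop. (2.6) (1) over the
centre. [cite: Kottwitz1992, §5 (p. 391)] -/
theorem Kottwitz1992_5_cases_holds : Kottwitz1992_5_cases.{u, v} := by
  intro B _ _ _ _ V _ _ D
  haveI := D.isSimpleRing
  haveI := D.finiteDimensional
  by_cases hA : IsCaseA B
  · /- §1 second kind -/
    obtain ⟨x, hx, hne⟩ := hA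
    exact Or.inl ⟨⟨x, hx, hne⟩, fun hC => hne (hC.1 x hx), fun hD => hne (hD.1 x hx)⟩
  · /- §2 first kind -/
    have hfix : ∀ x ∈ Subalgebra.center ℚ B, star x = x := fun x hx => by
      by_contra h
      exact hA ⟨x, hx, h⟩
    obtain ⟨d, hd0, hz0, hdim, hSym⟩ := firstKind_dichotomy B hfix
    -- `d` is determined by `dim_ℚ B = d² [F : ℚ]`
    have huniq : ∀ d' : ℕ, finrank ℚ B = d' ^ 2 * finrank ℚ (Subalgebra.center ℚ B) → d' = d := fun d' h => by
      rw [hdim] at h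
      exact (Nat.pow_left_injective two_ne_zero (Nat.eq_of_mul_eq_mul_right hz0 h)).symm
    have hzd : 0 < finrank ℚ (Subalgebra.center ℚ B) * d := Nat.mul_pos hz0 hd0
    rcases hSym with hO | hS
    · -- Case C
      refine Or.inr (Or.inl ⟨hA, ⟨hfix, d, hdim, hO⟩, fun hD => ?_⟩)
      obtain ⟨-, d', hdim', hD'⟩ := hD
      obtain rfl := huniq d' hdim'
      nlinarith [hO, hD', hzd]
    · -- Case D
      refine Or.inr (Or.inr ⟨hA, fun hC => ?_, ⟨hfix, d, hdim, hS⟩⟩)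
      obtain ⟨-, d', hdim', hC'⟩ := hC
      obtain rfl := huniq d' hdim'
      nlinarith [hS, hC', hzd]

end Literature.NumberTheory.Kottwitz1992.ModuliProblem

end
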